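import Mathlib
import HarnessLib

/-!
# Stieltjes / layer-cake conversion for `LinearCappedRepulsion` (stub `stub_stieltjes`)

Pure real analysis over a finite multiset of complex numbers `S`.  Write `N(t)` for the number
(with multiplicity) of `ρ ∈ S` with `‖1 - ρ‖ ≤ t`.  A zero-free disc (`‖1 - ρ‖ ≥ r₀ > 0` for every
`ρ ∈ S`), a NEAR count `N(t) ≤ A (1 + e t) ^ (3/2)` for `0 < t ≤ R₁ / e` and a GLOBAL count
`N(t) ≤ M (1 + e t) + B (1 + e t) ^ (3/2)` for all `t > 0`, with `M ≤ K₀ R₁` and `R₁ ≥ 1`, imply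
`Σ_{ρ ∈ S} ‖1 - ρ‖⁻² ≤ K` for a constant `K = K(A, B, K₀, r₀)` independent of `S`, `M`, `R₁`.

Proof: dyadic shells of ratio `e²` starting at `r₀`: a root with `r₀ e^{2k} ≤ ‖1 - ρ‖ < r₀ e^{2k+2}`
contributes at most `(r₀ e^{2k})⁻²`, so the sum is at most `Σ_k N(r₀ e^{2k+2}) (r₀ e^{2k})⁻²`
(finitely many shells since `S` is finite).  Shells below the threshold `k₀` (where
`e · r₀ e^{2k+2} ≤ R₁`) use the near count, the others the global count; the exponent `3/2 < 2`
makes the first contribution a geometric series in `e⁻¹`, and `R₁ ≤ r₀ e⁵ e^{2k₀}` together with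
`M ≤ K₀ R₁` makes the linear contribution of the shells `k ≥ k₀` a geometric series summing to
`O(K₀)`.  The shell lemmas below are stated for an arbitrary ratio parameter `E` (used with
`E = e`).
-/

namespace Summit.Parity.BatemanHorn.Cruxes.LinearCappedRepulsion.JensenStieltjesMajorant

open scoped BigOperators

/-- Summing a constant indicator over a multiset counts the filtered elements. -/
private lemma stieltjes_sum_map_ite_const {ι : Type*} (m : Multiset ι) (P : ι → Prop)
    [DecidablePred P] (v : ℝ) :
    (m.map fun s => if P s then v else 0).sum = v * ((m.filter P).card : ℝ) := by
  induction m using Multiset.induction_on with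
  | empty => simp
  | cons a m ih =>
    by_cases h : P a
    · rw [Multiset.map_cons, Multiset.sum_cons, ih, Multiset.filter_cons_of_pos _ h,
        Multiset.card_cons, if_pos h]
      push_cast
      ring
    · rw [Multiset.map_cons, Multiset.sum_cons, ih, Multiset.filter_cons_of_neg _ h, if_neg h,
        zero_add]

/-- Swapping a multiset sum with a finite sum. -/
private lemma stieltjes_sum_map_finset_sum {ι κ : Type*} (m : Multiset ι) (u : Finset κ)
    (g : ι → κ → ℝ) :
    (m.map fun s => ∑ i ∈ u, g s i).sum = ∑ i ∈ u, (m.map fun s => g s i).sum := by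
  induction m using Multiset.induction_on with
  | empty => simp
  | cons a m ih => simp [ih, Finset.sum_add_distrib]

/-- Locating the near/far threshold shell for a ratio parameter `E > 1`: below `k₀` the near
count applies (`r₀ E³ (E²)^k ≤ R₁`), and `R₁ ≤ r₀ E⁵ (E²)^{k₀}`. -/
private lemma stieltjes_exists_threshold {r₀ E : ℝ} (hr₀ : 0 < r₀) (hE : 1 < E) (R₁ : ℝ) :
    ∃ k₀ : ℕ, (∀ k : ℕ, k < k₀ → r₀ * E ^ 3 * (E ^ 2) ^ k ≤ R₁) ∧
      R₁ ≤ r₀ * E ^ 5 * (E ^ 2) ^ k₀ := by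
  have hE0 : 0 < E := one_pos.trans hE
  have hE2 : 1 < E ^ 2 := one_lt_pow₀ hE two_ne_zero
  have hpos : 0 < r₀ * E ^ 3 := by positivity
  by_cases hlt : R₁ < r₀ * E ^ 3
  · refine ⟨0, fun k hk => (Nat.not_lt_zero k hk).elim, ?_⟩
    have h35 : r₀ * E ^ 3 ≤ r₀ * E ^ 5 :=
      mul_le_mul_of_nonneg_left (pow_le_pow_right₀ hE.le (by norm_num)) hr₀.le
    rw [pow_zero, mul_one]
    exact hlt.le.trans h35
  · push Not at hlt
    have hx : 1 ≤ R₁ / (r₀ * E ^ 3) := by rwa [le_div_iff₀ hpos, one_mul]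
    obtain ⟨n, hn1, hn2⟩ := exists_nat_pow_near hx hE2
    refine ⟨n, fun k hk => ?_, ?_⟩
    · have hk' : (E ^ 2) ^ k ≤ (E ^ 2) ^ n := pow_le_pow_right₀ hE2.le hk.le
      have h := hk'.trans hn1
      rw [le_div_iff₀ hpos] at h
      linarith [h]
    · rw [div_lt_iff₀ hpos] at hn2
      have h : (E ^ 2) ^ (n + 1) * (r₀ * E ^ 3) = r₀ * E ^ 5 * (E ^ 2) ^ n := by ring
      linarith [h]

/-- Shell `k`, the `3/2`-power part, for a ratio parameter `E ≥ 1`: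
`(r₀ E^{2k})⁻² (1 + E · r₀ (E²)^{k+1})^{3/2} ≤ r₀⁻² (1 + r₀ E³)^{3/2} E^{-k}`. -/
private lemma stieltjes_shell_rpow_bound {r₀ E : ℝ} (hr₀ : 0 < r₀) (hE1 : 1 ≤ E) (k : ℕ) :
    ((r₀ * (E ^ 2) ^ k) ^ 2)⁻¹ * (1 + E * (r₀ * (E ^ 2) ^ (k + 1))) ^ (3 / 2 : ℝ) ≤
      (r₀ ^ 2)⁻¹ * (1 + r₀ * E ^ 3) ^ (3 / 2 : ℝ) * (E⁻¹) ^ k := by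
  have hE0 : 0 < E := one_pos.trans_le hE1
  set u : ℝ := E ^ k with hu
  have hu0 : 0 < u := pow_pos hE0 k
  have hu1 : 1 ≤ u := one_le_pow₀ hE1
  have hEk : (E ^ 2) ^ k = u ^ 2 := by rw [← pow_mul, mul_comm, pow_mul]
  have hD0 : 0 ≤ 1 + r₀ * E ^ 3 := by positivity
  have h1 : 1 + E * (r₀ * (E ^ 2) ^ (k + 1)) ≤ (1 + r₀ * E ^ 3) * u ^ 2 := by
    rw [pow_succ (E ^ 2) k, hEk]
    have hu2 : 1 ≤ u ^ 2 := one_le_pow₀ hu1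
    have hc : 0 ≤ r₀ * E ^ 3 := by positivity
    nlinarith [hu2, hc]
  have h2 : (1 + E * (r₀ * (E ^ 2) ^ (k + 1))) ^ (3 / 2 : ℝ) ≤
      ((1 + r₀ * E ^ 3) * u ^ 2) ^ (3 / 2 : ℝ) :=
    Real.rpow_le_rpow (by positivity) h1 (by norm_num)
  have h3 : ((1 + r₀ * E ^ 3) * u ^ 2) ^ (3 / 2 : ℝ) = (1 + r₀ * E ^ 3) ^ (3 / 2 : ℝ) * u ^ 3 := by
    rw [Real.mul_rpow hD0 (by positivity)]
    congr 1
    rw [← Real.rpow_natCast u 2, ← Real.rpow_mul hu0.le, ← Real.rpow_natCast u 3]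
    norm_num
  have hw : ((r₀ * (E ^ 2) ^ k) ^ 2)⁻¹ = (r₀ ^ 2)⁻¹ * (u ^ 4)⁻¹ := by
    rw [hEk, mul_pow, ← pow_mul, mul_inv]
  have hEinv : (E⁻¹) ^ k = u⁻¹ := by rw [inv_pow]
  rw [hw, hEinv]
  calc (r₀ ^ 2)⁻¹ * (u ^ 4)⁻¹ * (1 + E * (r₀ * (E ^ 2) ^ (k + 1))) ^ (3 / 2 : ℝ)
      ≤ (r₀ ^ 2)⁻¹ * (u ^ 4)⁻¹ * ((1 + r₀ * E ^ 3) ^ (3 / 2 : ℝ) * u ^ 3) := by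
        rw [← h3]
        exact mul_le_mul_of_nonneg_left h2 (by positivity)
    _ = (r₀ ^ 2)⁻¹ * (1 + r₀ * E ^ 3) ^ (3 / 2 : ℝ) * u⁻¹ := by
        field_simp

/-- Shell `k`, the linear part, for a ratio parameter `E > 0` and `R₁ ≥ 1`:
`(r₀ E^{2k})⁻² (1 + E · r₀ (E²)^{k+1}) ≤ R₁ r₀⁻² (E⁴)^{-k} + r₀⁻¹ E³ (E²)^{-k}`. -/
private lemma stieltjes_shell_lin_bound {r₀ E R₁ : ℝ} (hr₀ : 0 < r₀) (hE0 : 0 < E) (hR₁ : 1 ≤ R₁)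
    (k : ℕ) :
    ((r₀ * (E ^ 2) ^ k) ^ 2)⁻¹ * (1 + E * (r₀ * (E ^ 2) ^ (k + 1))) ≤
      R₁ * (r₀ ^ 2)⁻¹ * ((E ^ 4)⁻¹) ^ k + r₀⁻¹ * E ^ 3 * ((E ^ 2)⁻¹) ^ k := by
  set u : ℝ := E ^ k with hu
  have hu0 : 0 < u := pow_pos hE0 k
  have hEk : (E ^ 2) ^ k = u ^ 2 := by rw [← pow_mul, mul_comm, pow_mul]
  have hE4k : ((E ^ 4)⁻¹) ^ k = (u ^ 4)⁻¹ := by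
    rw [inv_pow, ← pow_mul, show 4 * k = k * 4 by ring, pow_mul]
  have hE2k : ((E ^ 2)⁻¹) ^ k = (u ^ 2)⁻¹ := by rw [inv_pow, hEk]
  rw [hE4k, hE2k, pow_succ (E ^ 2) k, hEk]
  have hw0 : 0 ≤ ((r₀ * u ^ 2) ^ 2)⁻¹ := by positivity
  calc ((r₀ * u ^ 2) ^ 2)⁻¹ * (1 + E * (r₀ * (u ^ 2 * E ^ 2)))
      ≤ ((r₀ * u ^ 2) ^ 2)⁻¹ * (R₁ + E * (r₀ * (u ^ 2 * E ^ 2))) := by gcongr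
    _ = R₁ * (r₀ ^ 2)⁻¹ * (u ^ 4)⁻¹ + r₀⁻¹ * E ^ 3 * (u ^ 2)⁻¹ := by
        field_simp

/-- **Stub (Stieltjes / layer-cake conversion).**  For `A, B, K₀ ≥ 0` and `r₀ > 0` there is a
constant `K` such that for every finite multiset `S` of complex numbers and all `M ≥ 0`, `R₁ ≥ 1`
with `M ≤ K₀ R₁`: if every `ρ ∈ S` has `‖1 - ρ‖ ≥ r₀`, the counting function
`N(t) = #{ρ ∈ S : ‖1 - ρ‖ ≤ t}` satisfies the near bound `N(t) ≤ A (1 + e t)^{3/2}` for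
`0 < t`, `e t ≤ R₁`, and the global bound `N(t) ≤ M (1 + e t) + B (1 + e t)^{3/2}` for `t > 0`,
then `Σ_{ρ ∈ S} ‖1 - ρ‖⁻² ≤ K`. -/
theorem stub_stieltjes :
    ∀ (A B K₀ r₀ : ℝ), 0 ≤ A → 0 ≤ B → 0 ≤ K₀ → 0 < r₀ → ∃ K : ℝ, ∀ (S : Multiset ℂ) (M R₁ : ℝ),
      0 ≤ M → 1 ≤ R₁ → M ≤ K₀ * R₁ →
      (∀ ρ ∈ S, r₀ ≤ ‖(1 : ℂ) - ρ‖) →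
      (∀ t : ℝ, 0 < t → Real.exp 1 * t ≤ R₁ →
        ((S.filter fun ρ : ℂ => ‖(1 : ℂ) - ρ‖ ≤ t).card : ℝ) ≤ A * (1 + Real.exp 1 * t) ^ (3 / 2 : ℝ)) →
      (∀ t : ℝ, 0 < t →
        ((S.filter fun ρ : ℂ => ‖(1 : ℂ) - ρ‖ ≤ t).card : ℝ) ≤
          M * (1 + Real.exp 1 * t) + B * (1 + Real.exp 1 * t) ^ (3 / 2 : ℝ)) →
      (S.map fun ρ : ℂ => (‖(1 : ℂ) - ρ‖ ^ 2)⁻¹).sum ≤ K := by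
  intro A B K₀ r₀ hA hB hK₀ hr₀
  -- numerics of `e`, then abbreviate `E := e`
  have hE1 : (1 : ℝ) < Real.exp 1 := by
    have := Real.exp_one_gt_d9
    linarith
  have h2E : (2 : ℝ) ≤ Real.exp 1 ^ 2 := by nlinarith [Real.add_one_le_exp (1 : ℝ)]
  set E : ℝ := Real.exp 1 with hE
  have hE0 : 0 < E := one_pos.trans hE1
  have hE2 : 1 < E ^ 2 := one_lt_pow₀ hE1 two_ne_zero
  have hE4 : 1 < E ^ 4 := one_lt_pow₀ hE1 (by norm_num)
  have hq1 : E⁻¹ < 1 := inv_lt_one_of_one_lt₀ hE1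
  have hq2 : (E ^ 2)⁻¹ < 1 := inv_lt_one_of_one_lt₀ hE2
  have hq4 : (E ^ 4)⁻¹ < 1 := inv_lt_one_of_one_lt₀ hE4
  have hd2 : 0 < 1 - (E ^ 2)⁻¹ := sub_pos.2 hq2
  have hd4 : 0 < 1 - (E ^ 4)⁻¹ := sub_pos.2 hq4
  -- the constants
  set C : ℝ := (r₀ ^ 2)⁻¹ * (1 + r₀ * E ^ 3) ^ (3 / 2 : ℝ) with hC
  have hC0 : 0 ≤ C := by positivity
  refine ⟨(A + B) * (C / (1 - E⁻¹)) + K₀ * (E ^ 10 / (1 - (E ^ 4)⁻¹) + E ^ 8 / (1 - (E ^ 2)⁻¹)), ?_⟩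
  intro S M R₁ hM hR₁ hMK hfree hnear hglob
  have hR₁0 : 0 < R₁ := one_pos.trans_le hR₁
  have hMR : M / R₁ ≤ K₀ := by rwa [div_le_iff₀ hR₁0]
  -- Step 1: every root lies in a shell `r₀ (E²)^k ≤ ‖1 - ρ‖ < r₀ (E²)^(k+1)` with `k < K₁`.
  set K₁ : ℕ := ⌊(S.map fun ρ : ℂ => ‖(1 : ℂ) - ρ‖ / r₀).sum⌋₊ + 1 with hK₁
  have hshell : ∀ ρ ∈ S, ∃ k : ℕ, k < K₁ ∧ r₀ * (E ^ 2) ^ k ≤ ‖(1 : ℂ) - ρ‖ ∧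
      ‖(1 : ℂ) - ρ‖ < r₀ * (E ^ 2) ^ (k + 1) := by
    intro ρ hρ
    have hx : 1 ≤ ‖(1 : ℂ) - ρ‖ / r₀ := by rw [le_div_iff₀ hr₀, one_mul]; exact hfree ρ hρ
    obtain ⟨k, hk1, hk2⟩ := exists_nat_pow_near hx hE2
    refine ⟨k, ?_, ?_, ?_⟩
    · have hsum : ‖(1 : ℂ) - ρ‖ / r₀ ≤ (S.map fun ρ : ℂ => ‖(1 : ℂ) - ρ‖ / r₀).sum := by
        refine Multiset.single_le_sum (fun x hx' => ?_) _ (Multiset.mem_map_of_mem _ hρ)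
        obtain ⟨ρ', _, rfl⟩ := Multiset.mem_map.1 hx'
        positivity
      have h2k : (k : ℝ) < 2 ^ k := by exact_mod_cast Nat.lt_two_pow_self
      have h2Ek : (2 : ℝ) ^ k ≤ (E ^ 2) ^ k := pow_le_pow_left₀ (by norm_num) h2E k
      have hlt : (k : ℝ) < K₁ := by
        calc (k : ℝ) ≤ (S.map fun ρ : ℂ => ‖(1 : ℂ) - ρ‖ / r₀).sum := by linarith
          _ < ⌊(S.map fun ρ : ℂ => ‖(1 : ℂ) - ρ‖ / r₀).sum⌋₊ + 1 := Nat.lt_floor_add_one _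
          _ = (K₁ : ℝ) := by rw [hK₁]; push_cast; ring
      exact_mod_cast hlt
    · rw [le_div_iff₀ hr₀] at hk1
      linarith [hk1]
    · rw [div_lt_iff₀ hr₀] at hk2
      linarith [hk2]
  -- Step 2: each root's inverse square is bounded by the sum of the shell weights it meets.
  have hroot : ∀ ρ ∈ S, (‖(1 : ℂ) - ρ‖ ^ 2)⁻¹ ≤
      ∑ k ∈ Finset.range K₁,
        (if ‖(1 : ℂ) - ρ‖ ≤ r₀ * (E ^ 2) ^ (k + 1) then ((r₀ * (E ^ 2) ^ k) ^ 2)⁻¹ else 0) := by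
    intro ρ hρ
    obtain ⟨k, hkK, hk1, hk2⟩ := hshell ρ hρ
    have hpos : 0 < r₀ * (E ^ 2) ^ k := by positivity
    calc (‖(1 : ℂ) - ρ‖ ^ 2)⁻¹ ≤ ((r₀ * (E ^ 2) ^ k) ^ 2)⁻¹ := by
          apply inv_anti₀ (by positivity)
          exact pow_le_pow_left₀ hpos.le hk1 2
      _ = (if ‖(1 : ℂ) - ρ‖ ≤ r₀ * (E ^ 2) ^ (k + 1) then ((r₀ * (E ^ 2) ^ k) ^ 2)⁻¹ else 0) := by
          rw [if_pos hk2.le]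
      _ ≤ ∑ k ∈ Finset.range K₁,
            (if ‖(1 : ℂ) - ρ‖ ≤ r₀ * (E ^ 2) ^ (k + 1) then ((r₀ * (E ^ 2) ^ k) ^ 2)⁻¹ else 0) := by
          refine Finset.single_le_sum (f := fun k =>
            (if ‖(1 : ℂ) - ρ‖ ≤ r₀ * (E ^ 2) ^ (k + 1) then ((r₀ * (E ^ 2) ^ k) ^ 2)⁻¹ else 0))
            (fun i _ => ?_) (Finset.mem_range.2 hkK)
          split_ifs <;> positivity
  -- Step 3: sum over the roots and swap the sums: `Σ_ρ ‖1-ρ‖⁻² ≤ Σ_k w_k N(t_{k+1})`.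
  have hswap : (S.map fun ρ : ℂ => (‖(1 : ℂ) - ρ‖ ^ 2)⁻¹).sum ≤
      ∑ k ∈ Finset.range K₁, ((r₀ * (E ^ 2) ^ k) ^ 2)⁻¹ *
        ((S.filter fun ρ : ℂ => ‖(1 : ℂ) - ρ‖ ≤ r₀ * (E ^ 2) ^ (k + 1)).card : ℝ) := by
    calc (S.map fun ρ : ℂ => (‖(1 : ℂ) - ρ‖ ^ 2)⁻¹).sum
        ≤ (S.map fun ρ : ℂ => ∑ k ∈ Finset.range K₁,
            (if ‖(1 : ℂ) - ρ‖ ≤ r₀ * (E ^ 2) ^ (k + 1) then ((r₀ * (E ^ 2) ^ k) ^ 2)⁻¹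
              else 0)).sum :=
          Multiset.sum_map_le_sum_map _ _ hroot
      _ = ∑ k ∈ Finset.range K₁, (S.map fun ρ : ℂ =>
            (if ‖(1 : ℂ) - ρ‖ ≤ r₀ * (E ^ 2) ^ (k + 1) then ((r₀ * (E ^ 2) ^ k) ^ 2)⁻¹
              else 0)).sum :=
          stieltjes_sum_map_finset_sum _ _ _
      _ = _ := by
          refine Finset.sum_congr rfl fun k _ => ?_
          rw [stieltjes_sum_map_ite_const]
  -- Step 4: the threshold shell and the termwise bound.
  obtain ⟨k₀, hk0near, hk0far⟩ := stieltjes_exists_threshold hr₀ hE1 R₁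
  have hterm : ∀ k : ℕ, ((r₀ * (E ^ 2) ^ k) ^ 2)⁻¹ *
        ((S.filter fun ρ : ℂ => ‖(1 : ℂ) - ρ‖ ≤ r₀ * (E ^ 2) ^ (k + 1)).card : ℝ) ≤
      (A + B) * (C * (E⁻¹) ^ k) +
      (if k₀ ≤ k then
        M * (R₁ * (r₀ ^ 2)⁻¹ * ((E ^ 4)⁻¹) ^ k + r₀⁻¹ * E ^ 3 * ((E ^ 2)⁻¹) ^ k) else 0) := by
    intro k
    have ht0 : 0 < r₀ * (E ^ 2) ^ (k + 1) := by positivity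
    have hw0 : 0 ≤ ((r₀ * (E ^ 2) ^ k) ^ 2)⁻¹ := by positivity
    have hEt : E * (r₀ * (E ^ 2) ^ (k + 1)) = r₀ * E ^ 3 * (E ^ 2) ^ k := by ring
    have hrp : ((r₀ * (E ^ 2) ^ k) ^ 2)⁻¹ * (1 + E * (r₀ * (E ^ 2) ^ (k + 1))) ^ (3 / 2 : ℝ) ≤
        C * (E⁻¹) ^ k := stieltjes_shell_rpow_bound hr₀ hE1.le k
    have hrp0 : 0 ≤ ((r₀ * (E ^ 2) ^ k) ^ 2)⁻¹ *
        (1 + E * (r₀ * (E ^ 2) ^ (k + 1))) ^ (3 / 2 : ℝ) := by positivity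
    have hAB : 0 ≤ A + B := add_nonneg hA hB
    by_cases hk : k₀ ≤ k
    · rw [if_pos hk]
      have hN := hglob (r₀ * (E ^ 2) ^ (k + 1)) ht0
      have hlin : ((r₀ * (E ^ 2) ^ k) ^ 2)⁻¹ * (1 + E * (r₀ * (E ^ 2) ^ (k + 1))) ≤
          R₁ * (r₀ ^ 2)⁻¹ * ((E ^ 4)⁻¹) ^ k + r₀⁻¹ * E ^ 3 * ((E ^ 2)⁻¹) ^ k :=
        stieltjes_shell_lin_bound hr₀ hE0 hR₁ k
      calc ((r₀ * (E ^ 2) ^ k) ^ 2)⁻¹ *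
            ((S.filter fun ρ : ℂ => ‖(1 : ℂ) - ρ‖ ≤ r₀ * (E ^ 2) ^ (k + 1)).card : ℝ)
          ≤ ((r₀ * (E ^ 2) ^ k) ^ 2)⁻¹ * (M * (1 + E * (r₀ * (E ^ 2) ^ (k + 1))) +
              B * (1 + E * (r₀ * (E ^ 2) ^ (k + 1))) ^ (3 / 2 : ℝ)) :=
            mul_le_mul_of_nonneg_left hN hw0
        _ = B * (((r₀ * (E ^ 2) ^ k) ^ 2)⁻¹ * (1 + E * (r₀ * (E ^ 2) ^ (k + 1))) ^ (3 / 2 : ℝ)) +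
              M * (((r₀ * (E ^ 2) ^ k) ^ 2)⁻¹ * (1 + E * (r₀ * (E ^ 2) ^ (k + 1)))) := by
            ring
        _ ≤ (A + B) * (((r₀ * (E ^ 2) ^ k) ^ 2)⁻¹ *
              (1 + E * (r₀ * (E ^ 2) ^ (k + 1))) ^ (3 / 2 : ℝ)) +
              M * (((r₀ * (E ^ 2) ^ k) ^ 2)⁻¹ * (1 + E * (r₀ * (E ^ 2) ^ (k + 1)))) := by
            nlinarith [mul_nonneg hA hrp0]
        _ ≤ (A + B) * (C * (E⁻¹) ^ k) +
              M * (R₁ * (r₀ ^ 2)⁻¹ * ((E ^ 4)⁻¹) ^ k + r₀⁻¹ * E ^ 3 * ((E ^ 2)⁻¹) ^ k) := by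
            gcongr
    · rw [if_neg hk, add_zero]
      push Not at hk
      have hEt' : E * (r₀ * (E ^ 2) ^ (k + 1)) ≤ R₁ := by rw [hEt]; exact hk0near k hk
      have hN := hnear (r₀ * (E ^ 2) ^ (k + 1)) ht0 hEt'
      calc ((r₀ * (E ^ 2) ^ k) ^ 2)⁻¹ *
            ((S.filter fun ρ : ℂ => ‖(1 : ℂ) - ρ‖ ≤ r₀ * (E ^ 2) ^ (k + 1)).card : ℝ)
          ≤ ((r₀ * (E ^ 2) ^ k) ^ 2)⁻¹ * (A * (1 + E * (r₀ * (E ^ 2) ^ (k + 1))) ^ (3 / 2 : ℝ)) :=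
            mul_le_mul_of_nonneg_left hN hw0
        _ = A * (((r₀ * (E ^ 2) ^ k) ^ 2)⁻¹ *
              (1 + E * (r₀ * (E ^ 2) ^ (k + 1))) ^ (3 / 2 : ℝ)) := by ring
        _ ≤ (A + B) * (((r₀ * (E ^ 2) ^ k) ^ 2)⁻¹ *
              (1 + E * (r₀ * (E ^ 2) ^ (k + 1))) ^ (3 / 2 : ℝ)) := by
            nlinarith [mul_nonneg hB hrp0]
        _ ≤ (A + B) * (C * (E⁻¹) ^ k) := by gcongr
  -- Step 5: sum the termwise bounds (two geometric series).
  have hgeom1 : ∑ k ∈ Finset.range K₁, (E⁻¹) ^ k ≤ 1 / (1 - E⁻¹) := by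
    have h := geom_sum_Ico_le_of_lt_one (m := 0) (n := K₁) (inv_nonneg.2 hE0.le) hq1
    rwa [pow_zero, ← Finset.range_eq_Ico] at h
  have hsumite : ∑ k ∈ Finset.range K₁, (if k₀ ≤ k then
        M * (R₁ * (r₀ ^ 2)⁻¹ * ((E ^ 4)⁻¹) ^ k + r₀⁻¹ * E ^ 3 * ((E ^ 2)⁻¹) ^ k) else 0) =
      ∑ k ∈ Finset.Ico k₀ K₁,
        M * (R₁ * (r₀ ^ 2)⁻¹ * ((E ^ 4)⁻¹) ^ k + r₀⁻¹ * E ^ 3 * ((E ^ 2)⁻¹) ^ k) := by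
    rw [← Finset.sum_filter]
    refine Finset.sum_congr ?_ fun _ _ => rfl
    ext k
    simp only [Finset.mem_filter, Finset.mem_range, Finset.mem_Ico]
    tauto
  set V : ℝ := (E ^ 2) ^ k₀ with hV
  have hV0 : 0 < V := by positivity
  have hV1 : ((E ^ 2)⁻¹) ^ k₀ = V⁻¹ := by rw [inv_pow]
  have hV2 : ((E ^ 4)⁻¹) ^ k₀ = (V ^ 2)⁻¹ := by
    rw [inv_pow, hV]
    congr 1
    ring
  have hgeom4 : ∑ k ∈ Finset.Ico k₀ K₁, ((E ^ 4)⁻¹) ^ k ≤ (V ^ 2)⁻¹ / (1 - (E ^ 4)⁻¹) := by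
    have h := geom_sum_Ico_le_of_lt_one (m := k₀) (n := K₁) (inv_nonneg.2 (by positivity)) hq4
    rwa [hV2] at h
  have hgeom2 : ∑ k ∈ Finset.Ico k₀ K₁, ((E ^ 2)⁻¹) ^ k ≤ V⁻¹ / (1 - (E ^ 2)⁻¹) := by
    have h := geom_sum_Ico_le_of_lt_one (m := k₀) (n := K₁) (inv_nonneg.2 (by positivity)) hq2
    rwa [hV1] at h
  have hVinv : V⁻¹ ≤ r₀ * E ^ 5 / R₁ := by
    rw [le_div_iff₀ hR₁0]
    calc V⁻¹ * R₁ ≤ V⁻¹ * (r₀ * E ^ 5 * V) := mul_le_mul_of_nonneg_left hk0far (by positivity)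
      _ = r₀ * E ^ 5 := by field_simp
  have hVinv2 : (V ^ 2)⁻¹ ≤ (r₀ * E ^ 5 / R₁) ^ 2 := by
    rw [← inv_pow]
    exact pow_le_pow_left₀ (by positivity) hVinv 2
  -- the two linear pieces are `O(K₀)`
  have hlin4 : M * (R₁ * (r₀ ^ 2)⁻¹) * ((V ^ 2)⁻¹ / (1 - (E ^ 4)⁻¹)) ≤
      K₀ * (E ^ 10 / (1 - (E ^ 4)⁻¹)) := by
    calc M * (R₁ * (r₀ ^ 2)⁻¹) * ((V ^ 2)⁻¹ / (1 - (E ^ 4)⁻¹))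
        ≤ M * (R₁ * (r₀ ^ 2)⁻¹) * ((r₀ * E ^ 5 / R₁) ^ 2 / (1 - (E ^ 4)⁻¹)) := by gcongr
      _ = (M / R₁) * (E ^ 10 / (1 - (E ^ 4)⁻¹)) := by
          field_simp
      _ ≤ K₀ * (E ^ 10 / (1 - (E ^ 4)⁻¹)) :=
          mul_le_mul_of_nonneg_right hMR (div_nonneg (by positivity) hd4.le)
  have hlin2 : M * (r₀⁻¹ * E ^ 3) * (V⁻¹ / (1 - (E ^ 2)⁻¹)) ≤ K₀ * (E ^ 8 / (1 - (E ^ 2)⁻¹)) := by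
    calc M * (r₀⁻¹ * E ^ 3) * (V⁻¹ / (1 - (E ^ 2)⁻¹))
        ≤ M * (r₀⁻¹ * E ^ 3) * ((r₀ * E ^ 5 / R₁) / (1 - (E ^ 2)⁻¹)) := by gcongr
      _ = (M / R₁) * (E ^ 8 / (1 - (E ^ 2)⁻¹)) := by
          field_simp
      _ ≤ K₀ * (E ^ 8 / (1 - (E ^ 2)⁻¹)) :=
          mul_le_mul_of_nonneg_right hMR (div_nonneg (by positivity) hd2.le)
  -- assembling
  have hsplit : ∑ k ∈ Finset.Ico k₀ K₁,
        M * (R₁ * (r₀ ^ 2)⁻¹ * ((E ^ 4)⁻¹) ^ k + r₀⁻¹ * E ^ 3 * ((E ^ 2)⁻¹) ^ k) =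
      M * (R₁ * (r₀ ^ 2)⁻¹) * ∑ k ∈ Finset.Ico k₀ K₁, ((E ^ 4)⁻¹) ^ k +
        M * (r₀⁻¹ * E ^ 3) * ∑ k ∈ Finset.Ico k₀ K₁, ((E ^ 2)⁻¹) ^ k := by
    rw [Finset.mul_sum, Finset.mul_sum, ← Finset.sum_add_distrib]
    refine Finset.sum_congr rfl fun k _ => by ring
  have hmain1 : ∑ k ∈ Finset.range K₁, (A + B) * (C * (E⁻¹) ^ k) =
      (A + B) * C * ∑ k ∈ Finset.range K₁, (E⁻¹) ^ k := by
    rw [Finset.mul_sum]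
    refine Finset.sum_congr rfl fun k _ => by ring
  calc (S.map fun ρ : ℂ => (‖(1 : ℂ) - ρ‖ ^ 2)⁻¹).sum
      ≤ ∑ k ∈ Finset.range K₁, ((r₀ * (E ^ 2) ^ k) ^ 2)⁻¹ *
          ((S.filter fun ρ : ℂ => ‖(1 : ℂ) - ρ‖ ≤ r₀ * (E ^ 2) ^ (k + 1)).card : ℝ) := hswap
    _ ≤ ∑ k ∈ Finset.range K₁, ((A + B) * (C * (E⁻¹) ^ k) +
          (if k₀ ≤ k then
            M * (R₁ * (r₀ ^ 2)⁻¹ * ((E ^ 4)⁻¹) ^ k + r₀⁻¹ * E ^ 3 * ((E ^ 2)⁻¹) ^ k) else 0)) :=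
        Finset.sum_le_sum fun k _ => hterm k
    _ = (A + B) * C * ∑ k ∈ Finset.range K₁, (E⁻¹) ^ k +
          (M * (R₁ * (r₀ ^ 2)⁻¹) * ∑ k ∈ Finset.Ico k₀ K₁, ((E ^ 4)⁻¹) ^ k +
            M * (r₀⁻¹ * E ^ 3) * ∑ k ∈ Finset.Ico k₀ K₁, ((E ^ 2)⁻¹) ^ k) := by
        rw [Finset.sum_add_distrib, hsumite, hsplit, hmain1]
    _ ≤ (A + B) * C * (1 / (1 - E⁻¹)) +
          (M * (R₁ * (r₀ ^ 2)⁻¹) * ((V ^ 2)⁻¹ / (1 - (E ^ 4)⁻¹)) +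
            M * (r₀⁻¹ * E ^ 3) * (V⁻¹ / (1 - (E ^ 2)⁻¹))) := by
        gcongr
    _ ≤ (A + B) * (C / (1 - E⁻¹)) + K₀ * (E ^ 10 / (1 - (E ^ 4)⁻¹) + E ^ 8 / (1 - (E ^ 2)⁻¹)) := by
        have h1 : (A + B) * C * (1 / (1 - E⁻¹)) = (A + B) * (C / (1 - E⁻¹)) := by ring
        rw [h1, mul_add]
        linarith [hlin4, hlin2]

end Summit.Parity.BatemanHorn.Cruxes.LinearCappedRepulsion.JensenStieltjesMajorant
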